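import Summits.Ventures.PercRepro.SixThreePairB
import Summits.Ventures.PercRepro.SixThreeLam

/-!
# PercRepro — the shares of the soft max-trace rule at `(6, 3)` and Theorem P₂'s `|B| ≥ 4` step (p2, gen 6)

mine-2's `MINE2-RLS.md` §19.3 CONSEQUENCES and §19.5: for a plane `G`, `B ⊆ G` of rank `3`, the share
`w(G, S) = f(G, S) / D(S)` of a witness `S = B ∪ X` is bounded below through the denominator bounds of
`SixThreeRule.lean` / `SixThreePair.lean` and Lemma Λ (`SixThreeLam.lean`):

* `share_single_ge`: `|B| ≥ 4`, `x ∉ G` ⇒ `w(G, B ∪ {x}) ≥ 2/5`;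
* `share_pair_ge`: `|B| ≥ 4`, `x ≠ x′ ∉ G` ⇒ `w(G, B ∪ {x, x′}) ≥ 3/32` (`≥ 3/14` for a generic pair,
  `share_pair_generic_ge`);
* `Lam_triple`, `share_triple_ge`: for an independent triple `T`, `Λ(T) = 3`, the single share is `≥ 1/4` and the
  generic pair share `≥ 1/10` (exact values of §19.4 (i)/(ii)); the crude bound for an `N`-parallel pair is `≥ 1/22`;
* `supply_ge_three_of_four_le` (**Theorem P₂, the `|B| ≥ 4` step**): with `6` points `W` outside `G`, the `6` single
  witnesses and the `15` pair witnesses already give `Σ_{S ∈ Y, S ∩ G = B} w(G, S) ≥ 6 · 2/5 + 15 · 3/32 > 3`, for any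
  family `Y` containing every set of rank `4` or `5` (the `Yq M 6 3` of `PerFlatTransfer.lean`).
-/

namespace PercRepro

namespace SixThree

open Finset ThmH

variable {α : Type*} [DecidableEq α] {M : Matroid α} [M.Finite]

/-! ### The share bounds (mine-2 §19.3 CONSEQUENCES) -/

/-- `6 (n + 1) ≤ 6^{n + 1}`. -/
theorem six_mul_le_six_pow (n : ℕ) : (6 : ℚ) * ((n : ℚ) + 1) ≤ (6 : ℚ) ^ (n + 1) := by
  have h : n + 1 ≤ 6 ^ n := Nat.lt_pow_self (by norm_num) (n := n)
  have h' : ((n : ℚ) + 1) ≤ (6 : ℚ) ^ n := by exact_mod_cast h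
  rw [pow_succ]
  nlinarith

/-- `2 |B| − 2 ≤ 6^{|B| − 3}`, `21 |B| − 18 ≤ 11 · 6^{|B| − 3}`, `9 |B| − 6 ≤ 5 · 6^{|B| − 3}` for `|B| ≥ 4`. -/
theorem six_pow_sub_three_ge {b : ℕ} (hb : 4 ≤ b) :
    2 * (b : ℚ) - 2 ≤ (6 : ℚ) ^ (b - 3) ∧ 21 * (b : ℚ) - 18 ≤ 11 * (6 : ℚ) ^ (b - 3) ∧
    9 * (b : ℚ) - 6 ≤ 5 * (6 : ℚ) ^ (b - 3) := by
  obtain ⟨n, rfl⟩ : ∃ n, b = n + 4 := ⟨b - 4, by omega⟩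
  rw [show n + 4 - 3 = n + 1 by omega]
  have h := six_mul_le_six_pow n
  push_cast
  refine ⟨by linarith, by linarith, by linarith⟩

/-- `D(S) ≥ 6^{|B| − 3} > 0` when `S ∩ G = B` has rank `3` (the plane `G` itself contributes). -/
theorem D_pos {G S B : Finset α} (hG : G ∈ planes M) (hSG : S ∩ G = B) (hr : M.eRk (B : Set α) = 3) :
    (6 : ℚ) ^ (B.card - 3) ≤ D M S ∧ 0 < D M S := by
  have h : fRule M G S ≤ D M S := by
    unfold D
    exact Finset.single_le_sum (fun P _ => fRule_nonneg M P S) hG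
  rw [fRule_eq_of_inter hSG hr] at h
  exact ⟨h, lt_of_lt_of_le (by positivity) h⟩

/-- **The single-point share** (mine-2 §19.3): for `|B| ≥ 4`, `x ∉ G`,
`w(G, B ∪ {x}) = 6^{|B| − 3} / D ≥ 6^{|B| − 3} / (2 · 6^{|B| − 3} + |B| − 1) ≥ 2/5`. -/
theorem share_single_ge (hs : Simple M) {G B : Finset α} (hG : G ∈ planes M) (hB : B ⊆ G)
    (hrB : M.eRk (B : Set α) = 3) (hb : 4 ≤ B.card) {x : α} (hx : x ∈ gr M) (hxG : x ∉ G) :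
    (2 / 5 : ℚ) ≤ fRule M G (insert x B) / D M (insert x B) := by
  have hBg : B ⊆ gr M := hB.trans (mem_planes.1 hG).1
  have hSG : (insert x B) ∩ G = B := by
    ext y
    rw [Finset.mem_inter, Finset.mem_insert]
    constructor
    · rintro ⟨rfl | hyB, hyG⟩
      · exact absurd hyG hxG
      · exact hyB
    · intro hyB
      exact ⟨Or.inr hyB, hB hyB⟩
  rw [fRule_eq_of_inter hSG hrB]
  obtain ⟨-, hDpos⟩ := D_pos hG hSG hrB
  have hD := D_single_le hs hG hB hrB hx hxG
  have hΛ := Lam_le hs hBg hrB hb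
  obtain ⟨h1, -, -⟩ := six_pow_sub_three_ge hb
  rw [le_div_iff₀ hDpos]
  have hp : (0 : ℚ) ≤ (6 : ℚ) ^ (B.card - 3) := by positivity
  nlinarith

/-- **The pair share** (mine-2 §19.3, the parallel-pair lower bound `w₂⁻`): for `|B| ≥ 4`, `x ≠ x′ ∉ G`,
`w(G, B ∪ {x, x′}) ≥ 6^{|B| − 3} / (7 · 6^{|B| − 3} + 7|B| − 6) ≥ 3/32`. -/
theorem share_pair_ge (hs : Simple M) {G B : Finset α} (hG : G ∈ planes M) (hB : B ⊆ G)
    (hrB : M.eRk (B : Set α) = 3) (hb : 4 ≤ B.card) {x x' : α} (hx : x ∈ gr M) (hx' : x' ∈ gr M)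
    (hxx' : x ≠ x') (hxG : x ∉ G) (hx'G : x' ∉ G) :
    (3 / 32 : ℚ) ≤ fRule M G (insert x (insert x' B)) / D M (insert x (insert x' B)) := by
  have hBg : B ⊆ gr M := hB.trans (mem_planes.1 hG).1
  have hSG := pair_inter_eq hB hxG hx'G
  rw [fRule_eq_of_inter hSG hrB]
  obtain ⟨-, hDpos⟩ := D_pos hG hSG hrB
  have hD := D_pair_le hs hG hB hrB hx hx' hxx' hxG hx'G
  have hΛ := Lam_le hs hBg hrB hb
  obtain ⟨-, h2, -⟩ := six_pow_sub_three_ge hb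
  rw [le_div_iff₀ hDpos]
  have hp : (0 : ℚ) ≤ (6 : ℚ) ^ (B.card - 3) := by positivity
  nlinarith

/-- **The generic pair share** (mine-2 §19.3, `w₂`): if moreover `ρ(B ∪ {x, x′}) = 5`,
`w(G, B ∪ {x, x′}) ≥ 6^{|B| − 3} / (3 · 6^{|B| − 3} + 3|B| − 2) ≥ 3/14`. -/
theorem share_pair_generic_ge (hs : Simple M) {G B : Finset α} (hG : G ∈ planes M) (hB : B ⊆ G)
    (hrB : M.eRk (B : Set α) = 3) (hb : 4 ≤ B.card) {x x' : α} (hx : x ∈ gr M) (hx' : x' ∈ gr M)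
    (hxx' : x ≠ x') (hxG : x ∉ G) (hx'G : x' ∉ G)
    (hr5 : M.eRk ((insert x (insert x' B) : Finset α) : Set α) = 5) :
    (3 / 14 : ℚ) ≤ fRule M G (insert x (insert x' B)) / D M (insert x (insert x' B)) := by
  have hBg : B ⊆ gr M := hB.trans (mem_planes.1 hG).1
  have hSG := pair_inter_eq hB hxG hx'G
  rw [fRule_eq_of_inter hSG hrB]
  obtain ⟨-, hDpos⟩ := D_pos hG hSG hrB
  have hD := D_pair_le_generic hs hG hB hrB hx hx' hxx' hxG hx'G hr5
  have hΛ := Lam_le hs hBg hrB hb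
  obtain ⟨-, -, h3⟩ := six_pow_sub_three_ge hb
  rw [le_div_iff₀ hDpos]
  have hp : (0 : ℚ) ≤ (6 : ℚ) ^ (B.card - 3) := by positivity
  nlinarith

/-- `Λ(T) = 3` for an independent triple `T` (its three pairs are the lines of `M|T`). -/
theorem Lam_triple (hs : Simple M) {T : Finset α} (hT : T ⊆ gr M) (hrT : M.eRk (T : Set α) = 3)
    (hT3 : T.card = 3) : Lam M T = 3 := by
  have hsum := sum_choose_linesOf hs hT
  rw [hT3, show Nat.choose 3 2 = 3 by decide] at hsum
  have hk : ∀ L ∈ linesOf M T, (L ∩ T).card = 2 := by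
    intro L hL
    have h1 := card_inter_le_of_linesOf hrT hL
    have h2 : 2 ≤ (L ∩ T).card := (Finset.mem_filter.1 hL).2
    omega
  unfold Lam
  have hterm : ∀ L ∈ linesOf M T, (6 : ℚ) ^ ((L ∩ T).card - 2) = (((L ∩ T).card.choose 2 : ℕ) : ℚ) := by
    intro L hL
    rw [hk L hL]
    norm_num
  rw [Finset.sum_congr rfl hterm, ← Nat.cast_sum, hsum]
  norm_num

/-- **The triple shares** (mine-2 §19.4 (i)/(ii)): for an independent triple `T ⊆ G` with `x ∉ G` the single-point
share is exactly `≥ 1/4`, and for `x ≠ x′ ∉ G` the pair share is `≥ 1/22` (crude: `D ≤ 1 + 6·3 + 3`; mine-2's exact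
`D ∈ {10, 12, 15}` needs the «two coplanar lines share a point» refinement, not formalised here) and `≥ 1/10` when
`ρ(T ∪ {x, x′}) = 5` (exact). -/
theorem share_triple_ge (hs : Simple M) {G T : Finset α} (hG : G ∈ planes M) (hT : T ⊆ G)
    (hrT : M.eRk (T : Set α) = 3) (hT3 : T.card = 3) {x x' : α} (hx : x ∈ gr M) (hx' : x' ∈ gr M)
    (hxx' : x ≠ x') (hxG : x ∉ G) (hx'G : x' ∉ G) :
    (1 / 4 : ℚ) ≤ fRule M G (insert x T) / D M (insert x T) ∧
    (1 / 22 : ℚ) ≤ fRule M G (insert x (insert x' T)) / D M (insert x (insert x' T)) ∧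
    (M.eRk ((insert x (insert x' T) : Finset α) : Set α) = 5 →
      (1 / 10 : ℚ) ≤ fRule M G (insert x (insert x' T)) / D M (insert x (insert x' T))) := by
  have hTg : T ⊆ gr M := hT.trans (mem_planes.1 hG).1
  have hΛ := Lam_triple hs hTg hrT hT3
  have hSG1 : (insert x T) ∩ G = T := by
    ext y
    rw [Finset.mem_inter, Finset.mem_insert]
    constructor
    · rintro ⟨rfl | hyT, hyG⟩
      · exact absurd hyG hxG
      · exact hyT
    · intro hyT
      exact ⟨Or.inr hyT, hT hyT⟩
  have hSG2 := pair_inter_eq hT hxG hx'G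
  refine ⟨?_, ?_, ?_⟩
  · rw [fRule_eq_of_inter hSG1 hrT]
    obtain ⟨-, hDpos⟩ := D_pos hG hSG1 hrT
    have hD := D_single_le hs hG hT hrT hx hxG
    rw [hT3, hΛ] at hD
    rw [hT3, le_div_iff₀ hDpos]
    norm_num at hD ⊢
    linarith
  · rw [fRule_eq_of_inter hSG2 hrT]
    obtain ⟨-, hDpos⟩ := D_pos hG hSG2 hrT
    have hD := D_pair_le hs hG hT hrT hx hx' hxx' hxG hx'G
    rw [hT3, hΛ] at hD
    rw [hT3, le_div_iff₀ hDpos]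
    norm_num at hD ⊢
    linarith
  · intro hr5
    rw [fRule_eq_of_inter hSG2 hrT]
    obtain ⟨-, hDpos⟩ := D_pos hG hSG2 hrT
    have hD := D_pair_le_generic hs hG hT hrT hx hx' hxx' hxG hx'G hr5
    rw [hT3, hΛ] at hD
    rw [hT3, le_div_iff₀ hDpos]
    norm_num at hD ⊢
    linarith

/-! ### Theorem P₂, the `|B| ≥ 4` step -/

/-- `{x, x′} ∪ B = insert x (insert x′ B)`. -/
theorem pair_union_eq (B : Finset α) (x x' : α) : ({x, x'} : Finset α) ∪ B = insert x (insert x' B) := by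
  ext y
  simp only [Finset.mem_union, Finset.mem_insert, Finset.mem_singleton]
  tauto

omit [M.Finite] in
/-- The rank of `B ∪ {x, x′}` is at most `ρ(B) + 2`. -/
theorem eRk_pair_insert_le (B : Finset α) (x x' : α) :
    M.eRk ((insert x (insert x' B) : Finset α) : Set α) ≤ M.eRk (B : Set α) + 2 := by
  calc M.eRk ((insert x (insert x' B) : Finset α) : Set α)
      ≤ M.eRk ((insert x' B : Finset α) : Set α) + 1 := eRk_insert_le_add_one _ _
    _ ≤ M.eRk (B : Set α) + 1 + 1 := add_le_add (eRk_insert_le_add_one _ _) (le_refl _)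
    _ = M.eRk (B : Set α) + 2 := by rw [add_assoc]; rfl

/-- **Theorem P₂, the `|B| ≥ 4` step** (mine-2 §19.5): let `G` be a plane, `B ⊆ G` of rank `3` with `|B| ≥ 4`, and
`W` a set of `6` points of the ground set outside `G`.  Then the `6` single-point witnesses `B ∪ {x}` (share `≥ 2/5`)
and the `15` pair witnesses `B ∪ {x, x′}` (share `≥ 3/32`), all in any family `Y` containing every set of rank `4` or
`5`, give `Σ_{S ∈ Y, S ∩ G = B} w(G, S) ≥ 6 · 2/5 + 15 · 3/32 > 3`. -/
theorem supply_ge_three_of_four_le (hs : Simple M) {G B W : Finset α} (hG : G ∈ planes M) (hB : B ⊆ G)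
    (hrB : M.eRk (B : Set α) = 3) (hb : 4 ≤ B.card) (hW : W ⊆ gr M) (hWG : Disjoint W G) (hW6 : W.card = 6)
    (Y : Finset (Finset α))
    (hY : ∀ S, S ⊆ gr M → (3 : ℕ∞) < M.eRk (S : Set α) → M.eRk (S : Set α) < 6 → S ∈ Y) :
    (3 : ℚ) ≤ ∑ S ∈ Y.filter (fun S => S ∩ G = B), fRule M G S / D M S := by
  classical
  have hBg : B ⊆ gr M := hB.trans (mem_planes.1 hG).1
  have hWB : ∀ x ∈ W, x ∉ B := fun x hx hxB => Finset.disjoint_left.1 hWG hx (hB hxB)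
  have hWG' : ∀ x ∈ W, x ∉ G := fun x hx => Finset.disjoint_left.1 hWG hx
  -- the single-point witnesses
  set T₁ := W.image (fun x => insert x B) with hT₁
  have hinj₁ : Set.InjOn (fun x => insert x B) (W : Set α) := by
    intro x hx x' hx' h
    simp only at h
    have : x ∈ insert x' B := by rw [← h]; exact Finset.mem_insert_self _ _
    rw [Finset.mem_insert] at this
    rcases this with rfl | hxB
    · rfl
    · exact absurd hxB (hWB x hx)
  have hT₁sub : T₁ ⊆ Y.filter (fun S => S ∩ G = B) := by
    intro S hS
    rw [hT₁, Finset.mem_image] at hS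
    obtain ⟨x, hx, rfl⟩ := hS
    rw [Finset.mem_filter]
    have hr4 := eRk_insert_eq_four hG hB hrB (hW hx) (hWG' x hx)
    refine ⟨hY _ (Finset.insert_subset (hW hx) hBg) (by rw [hr4]; decide) (by rw [hr4]; decide), ?_⟩
    ext y
    rw [Finset.mem_inter, Finset.mem_insert]
    constructor
    · rintro ⟨rfl | hyB, hyG⟩
      · exact absurd hyG (hWG' y hx)
      · exact hyB
    · intro hyB
      exact ⟨Or.inr hyB, hB hyB⟩
  have hsum₁ : (6 : ℚ) * (2 / 5) ≤ ∑ S ∈ T₁, fRule M G S / D M S := by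
    rw [hT₁, Finset.sum_image hinj₁]
    calc (6 : ℚ) * (2 / 5) = ∑ _x ∈ W, (2 / 5 : ℚ) := by
          rw [Finset.sum_const, hW6, nsmul_eq_mul]; norm_num
      _ ≤ ∑ x ∈ W, fRule M G (insert x B) / D M (insert x B) :=
          Finset.sum_le_sum (fun x hx => share_single_ge hs hG hB hrB hb (hW hx) (hWG' x hx))
  -- the pair witnesses
  set T₂ := (W.powersetCard 2).image (fun X => X ∪ B) with hT₂
  have hinj₂ : Set.InjOn (fun X => X ∪ B) ((W.powersetCard 2 : Finset (Finset α)) : Set (Finset α)) := by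
    intro X hX X' hX' h
    simp only [Finset.mem_coe, Finset.mem_powersetCard] at hX hX'
    simp only at h
    have hXB : Disjoint X B := Finset.disjoint_of_subset_left hX.1 hWG |>.mono_right hB
    have hX'B : Disjoint X' B := Finset.disjoint_of_subset_left hX'.1 hWG |>.mono_right hB
    rw [← Finset.union_sdiff_cancel_right hXB, ← Finset.union_sdiff_cancel_right hX'B, h]
  have hT₂sub : T₂ ⊆ Y.filter (fun S => S ∩ G = B) := by
    intro S hS
    rw [hT₂, Finset.mem_image] at hS
    obtain ⟨X, hX, rfl⟩ := hS
    rw [Finset.mem_powersetCard] at hX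
    obtain ⟨x, x', hxx', rfl⟩ := Finset.card_eq_two.1 hX.2
    have hx : x ∈ W := hX.1 (by simp)
    have hx' : x' ∈ W := hX.1 (by simp)
    rw [pair_union_eq, Finset.mem_filter]
    have hr4 := eRk_insert_eq_four hG hB hrB (hW hx') (hWG' x' hx')
    have hge : (4 : ℕ∞) ≤ M.eRk ((insert x (insert x' B) : Finset α) : Set α) := by
      rw [← hr4]
      exact M.eRk_mono (Finset.coe_subset.2 (Finset.subset_insert _ _))
    have hle : M.eRk ((insert x (insert x' B) : Finset α) : Set α) ≤ 5 := by
      have := eRk_pair_insert_le (M := M) B x x'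
      rw [hrB] at this
      exact this.trans (by norm_num)
    refine ⟨hY _ (Finset.insert_subset (hW hx) (Finset.insert_subset (hW hx') hBg))
      (lt_of_lt_of_le (by decide) hge) (lt_of_le_of_lt hle (by decide)), pair_inter_eq hB (hWG' x hx) (hWG' x' hx')⟩
  have hsum₂ : (15 : ℚ) * (3 / 32) ≤ ∑ S ∈ T₂, fRule M G S / D M S := by
    rw [hT₂, Finset.sum_image hinj₂]
    calc (15 : ℚ) * (3 / 32) = ∑ _X ∈ W.powersetCard 2, (3 / 32 : ℚ) := by
          rw [Finset.sum_const, Finset.card_powersetCard, hW6, nsmul_eq_mul]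
          norm_num [Nat.choose]
      _ ≤ ∑ X ∈ W.powersetCard 2, fRule M G (X ∪ B) / D M (X ∪ B) := by
          apply Finset.sum_le_sum
          intro X hX
          rw [Finset.mem_powersetCard] at hX
          obtain ⟨x, x', hxx', rfl⟩ := Finset.card_eq_two.1 hX.2
          have hx : x ∈ W := hX.1 (by simp)
          have hx' : x' ∈ W := hX.1 (by simp)
          rw [pair_union_eq]
          exact share_pair_ge hs hG hB hrB hb (hW hx) (hW hx') hxx' (hWG' x hx) (hWG' x' hx')
  -- the two families are disjoint (their members have sizes `|B| + 1` and `|B| + 2`)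
  have hdisj : Disjoint T₁ T₂ := by
    rw [Finset.disjoint_left]
    intro S hS₁ hS₂
    rw [hT₁, Finset.mem_image] at hS₁
    rw [hT₂, Finset.mem_image] at hS₂
    obtain ⟨x, hx, rfl⟩ := hS₁
    obtain ⟨X, hX, hXS⟩ := hS₂
    rw [Finset.mem_powersetCard] at hX
    have hXB : Disjoint X B := Finset.disjoint_of_subset_left hX.1 hWG |>.mono_right hB
    have hc1 : (insert x B).card = B.card + 1 := Finset.card_insert_of_notMem (hWB x hx)
    have hc2 : (X ∪ B).card = B.card + 2 := by
      rw [Finset.card_union_of_disjoint hXB, hX.2]; ring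
    rw [← hXS] at hc1
    omega
  calc (3 : ℚ) ≤ (6 : ℚ) * (2 / 5) + (15 : ℚ) * (3 / 32) := by norm_num
    _ ≤ ∑ S ∈ T₁, fRule M G S / D M S + ∑ S ∈ T₂, fRule M G S / D M S := add_le_add hsum₁ hsum₂
    _ = ∑ S ∈ T₁ ∪ T₂, fRule M G S / D M S := (Finset.sum_union hdisj).symm
    _ ≤ ∑ S ∈ Y.filter (fun S => S ∩ G = B), fRule M G S / D M S := by
        apply Finset.sum_le_sum_of_subset_of_nonneg (Finset.union_subset hT₁sub hT₂sub)
        intro S _ _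
        exact div_nonneg (fRule_nonneg M G S) (D_nonneg M S)

end SixThree

end PercRepro
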